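import Literature.NumberTheory.Automorphic.Zelevinsky1980.JacquetOfInducedMaximalParabolic
import Literature.NumberTheory.Automorphic.Zelevinsky1980.MaximalParabolicModulus
import HarnessLib

/-!
# The two orbits of `Q_{N-1,1}` on `Q_{N-1,1} \ GL_N`: the open cell criterion and the chart decomposition

Topic `NumberTheory/Automorphic/Zelevinsky1980`; theorems only (no definition, no named fact). Let `F` be a
non-archimedean local field, `P = Q_{N-1,1} = standardParabolicGL F (lastBlockLabel N)` (`N = n + 2`), `σ'`
a smooth representation of `P` and `I = Ind_P^{GL_N} σ'`. The group `P` has two orbits on `P \ GL_N`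
(Bernstein–Zelevinsky 1977, §7.1: "the closed orbit `Z` of the point `P e` and the open orbit `Y` of the
point `P w⁻¹`"); the open orbit `P w₀ P = GL_N ∖ P` is covered by the `N - 1` translates
`(P w₀ U_N) · w_i` of the open `(P, U_N)`-cell by the transpositions `w_i = (0 i)`, `i < N - 1`, of the
Levi. We prove:

* `mem_parabolicDoubleCoset_rev_iff_apply_ne_zero` — **the open cell criterion**: `g ∈ P w₀ U_N` iff
  `g_{N-1,0} ≠ 0` (the open cell is the complement of a hyperplane section);
* `exists_sum_smoothIndRep_swap_of_forall_toFun_eq_zero` — **the chart decomposition**: every `f ∈ I`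
  vanishing on `P` (i.e. supported on the open `P`-orbit) is a sum `∑_{i < N-1} w_i · f_i` with
  `f_i ∈ I_open` (functions vanishing off the open cell): cut `f` along the clopen sets
  `E_i = {g : i is the first index at which |g_{N-1,j}|, j < N-1, is maximal}`, which are left
  `P`-invariant and right invariant under a deep enough congruence subgroup on the support of `f`.

These are the two inputs (open cell, closed point) of the Mackey / geometric-lemma analysis of
`Ind_{Q_{N-1,1}}^{GL_N} σ'|_{Q_{N-1,1}}` used for the irreducibility of `(ν₀ ∘ det) × χ′`
(Zelevinsky 1980, Thm. 4.2, unitary characters).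

## References

* I. N. Bernstein, A. V. Zelevinsky, *Induced representations of reductive `p`-adic groups I*,
  Ann. Sci. ÉNS 10 (1977), Thm. 5.2, §7.1. [BernsteinZelevinskyASENS1977]
* A. V. Zelevinsky, *Induced representations of reductive `p`-adic groups II*, Ann. Sci. ÉNS 13
  (1980), §1.1, Thm. 4.2. [Zelevinsky1980]
-/

noncomputable section

open Matrix Literature.LinearAlgebra.Matrix.DiagonalTorus

namespace Literature.NumberTheory.Automorphic.Zelevinsky1980

open ValuativeRel Valued

variable {F : Type*} [Field F] {n : ℕ}

/-! ### The open cell criterion -/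

/-- **The open cell of `Q_{N-1,1}` is `{g : g_{N-1,0} ≠ 0}`**: `g ∈ P w₀ U_N` iff the first entry of the
last row of `g` is non-zero (for `g = p w₀ n'` this entry is `p_{N-1,N-1} ≠ 0`; conversely
`g = p w₀ n(y)` with `y_j = g_{N-1,j} / g_{N-1,0}`). [cite: BernsteinZelevinskyASENS1977, §7.1] -/
theorem mem_parabolicDoubleCoset_rev_iff_apply_ne_zero (g : GL (Fin (n + 2)) F) :
    g ∈ parabolicDoubleCoset (K := F) (lastBlockLabel (n + 2)) Fin.revPerm ↔
      (g : Matrix (Fin (n + 2)) (Fin (n + 2)) F) (Fin.last (n + 1)) 0 ≠ 0 := by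
  have hc : Monotone (lastBlockLabel (n + 2)) := monotone_lastBlockLabel (n + 2)
  have hlast0 : (Fin.last (n + 1) : Fin (n + 2)) ≠ 0 := by simp [Fin.ext_iff]
  -- the last row of `p w₀ n'` is `p_{N-1,N-1} · (1, y)`
  have hrow : ∀ {p n' : GL (Fin (n + 2)) F}, p ∈ standardParabolicGL F (lastBlockLabel (n + 2)) →
      n' ∈ oppositeCellRadical (K := F) (lastBlockLabel (n + 2)) → ∀ j,
      ((p * permGL Fin.revPerm * n' : GL (Fin (n + 2)) F) : Matrix (Fin (n + 2)) (Fin (n + 2)) F) (Fin.last (n + 1)) j =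
        (p : Matrix (Fin (n + 2)) (Fin (n + 2)) F) (Fin.last (n + 1)) (Fin.last (n + 1)) *
          (n' : Matrix (Fin (n + 2)) (Fin (n + 2)) F) 0 j := by
    intro p n' hp hn' j
    rw [Units.val_mul, Units.val_mul, Matrix.mul_apply, Finset.sum_eq_single (0 : Fin (n + 2))]
    · rw [Matrix.mul_apply, Finset.sum_eq_single (Fin.last (n + 1))]
      · rw [coe_permGL, permMatrix_apply', if_pos (by rw [Fin.revPerm_apply, Fin.rev_last]), mul_one]
      · intro l _ hl
        rw [(mem_standardParabolicGL_lastBlockLabel_iff p).1 hp l hl, zero_mul]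
      · intro h; exact absurd (Finset.mem_univ _) h
    · intro k _ hk
      have hk0 : (k : ℕ) ≠ 0 := fun h => hk (Fin.ext h)
      rw [apply_eq_one_of_mem_oppositeCellRadical hn' hk0, Matrix.mul_apply,
        Finset.sum_eq_single (Fin.last (n + 1))]
      · rw [coe_permGL, permMatrix_apply', Fin.revPerm_apply, Fin.rev_last, if_neg (Ne.symm hk), mul_zero, zero_mul]
      · intro l _ hl
        rw [(mem_standardParabolicGL_lastBlockLabel_iff p).1 hp l hl, zero_mul]
      · intro h; exact absurd (Finset.mem_univ _) h
    · intro h; exact absurd (Finset.mem_univ _) h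
  constructor
  · intro hg
    obtain ⟨p, hp, n', hn', rfl⟩ := (mem_parabolicDoubleCoset_rev_iff _ hc _).1 hg
    rw [hrow hp hn', apply_zero_zero_of_mem_oppositeCellRadical hn', mul_one]
    -- the diagonal entry of an invertible block triangular matrix is non-zero
    intro h
    have hdet : ((p : Matrix (Fin (n + 2)) (Fin (n + 2)) F) * ((p⁻¹ : GL (Fin (n + 2)) F) : Matrix (Fin (n + 2)) (Fin (n + 2)) F))
        (Fin.last (n + 1)) (Fin.last (n + 1)) = 1 := by
      rw [← Units.val_mul, mul_inv_cancel, Units.val_one, Matrix.one_apply_eq]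
    rw [Matrix.mul_apply, Finset.sum_eq_single (Fin.last (n + 1)), h, zero_mul] at hdet
    · exact zero_ne_one hdet
    · intro l _ hl
      rw [(mem_standardParabolicGL_lastBlockLabel_iff p).1 hp l hl, zero_mul]
    · intro h'; exact absurd (Finset.mem_univ _) h'
  · intro hg
    -- `n' = 1 + e_0 yᵀ` with `y_j = g_{N-1,j} / g_{N-1,0}` (`j ≠ 0`)
    set t : F := (g : Matrix (Fin (n + 2)) (Fin (n + 2)) F) (Fin.last (n + 1)) 0 with ht
    set Y : Matrix (Fin (n + 2)) (Fin (n + 2)) F := Matrix.of fun i j =>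
      if i = 0 ∧ j ≠ 0 then t⁻¹ * (g : Matrix (Fin (n + 2)) (Fin (n + 2)) F) (Fin.last (n + 1)) j else 0 with hY
    have hYY : Y * Y = 0 := by
      ext i k
      rw [Matrix.mul_apply, Matrix.zero_apply]
      refine Finset.sum_eq_zero fun j _ => ?_
      simp only [hY, Matrix.of_apply]
      by_cases h1 : i = 0 ∧ j ≠ 0
      · rw [if_neg (fun h2 : j = 0 ∧ k ≠ 0 => h1.2 h2.1), mul_zero]
      · rw [if_neg h1, zero_mul]
    let n' : GL (Fin (n + 2)) F :=
      ⟨1 + Y, 1 - Y, by rw [add_mul, mul_sub, mul_sub, one_mul, mul_one, one_mul, hYY]; abel,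
        by rw [sub_mul, mul_add, mul_add, one_mul, mul_one, one_mul, hYY]; abel⟩
    have hn'val : (n' : Matrix (Fin (n + 2)) (Fin (n + 2)) F) = 1 + Y := rfl
    have hn' : n' ∈ oppositeCellRadical (K := F) (lastBlockLabel (n + 2)) := by
      rw [mem_oppositeCellRadical_lastBlockLabel_iff]
      intro i j hij
      rw [hn'val, Matrix.add_apply, hY, Matrix.of_apply, if_neg, add_zero]
      rintro ⟨hi, hj⟩
      exact hij ⟨by rw [hi]; rfl, fun h => hj (Fin.ext h)⟩
    have hn'row : ∀ j : Fin (n + 2), t * (n' : Matrix (Fin (n + 2)) (Fin (n + 2)) F) 0 j =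
        (g : Matrix (Fin (n + 2)) (Fin (n + 2)) F) (Fin.last (n + 1)) j := by
      intro j
      rw [hn'val, Matrix.add_apply, hY, Matrix.of_apply]
      by_cases hj : j = 0
      · subst hj; rw [Matrix.one_apply_eq, if_neg (fun h => h.2 rfl), add_zero, mul_one]
      · rw [Matrix.one_apply_ne (Ne.symm hj), if_pos ⟨rfl, hj⟩, zero_add, mul_inv_cancel_left₀ hg]
    -- `p = g n'⁻¹ w₀⁻¹ ∈ P`
    set p : GL (Fin (n + 2)) F := g * n'⁻¹ * (permGL Fin.revPerm)⁻¹ with hp_def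
    have hg_eq : g = p * permGL Fin.revPerm * n' := by rw [hp_def]; group
    have hp : p ∈ standardParabolicGL F (lastBlockLabel (n + 2)) := by
      rw [mem_standardParabolicGL_lastBlockLabel_iff]
      intro j hj
      -- the last row of `g n'⁻¹` is `t e_0`, and `e_0 w₀⁻¹ = e_{N-1}`
      have h1 : ∀ k : Fin (n + 2), ((g * n'⁻¹ : GL (Fin (n + 2)) F) : Matrix (Fin (n + 2)) (Fin (n + 2)) F)
          (Fin.last (n + 1)) k = if k = 0 then t else 0 := by
        intro k
        have e1 : ((g * n'⁻¹ : GL (Fin (n + 2)) F) : Matrix (Fin (n + 2)) (Fin (n + 2)) F) (Fin.last (n + 1)) k =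
            ∑ l, (t * (n' : Matrix (Fin (n + 2)) (Fin (n + 2)) F) 0 l) *
              ((n'⁻¹ : GL (Fin (n + 2)) F) : Matrix (Fin (n + 2)) (Fin (n + 2)) F) l k := by
          rw [Units.val_mul, Matrix.mul_apply]
          exact Finset.sum_congr rfl fun l _ => by rw [hn'row]
        rw [e1]
        have e2 : ∑ l, (t * (n' : Matrix (Fin (n + 2)) (Fin (n + 2)) F) 0 l) *
            ((n'⁻¹ : GL (Fin (n + 2)) F) : Matrix (Fin (n + 2)) (Fin (n + 2)) F) l k =
            t * ((n' : Matrix (Fin (n + 2)) (Fin (n + 2)) F) * ((n'⁻¹ : GL (Fin (n + 2)) F) :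
              Matrix (Fin (n + 2)) (Fin (n + 2)) F)) 0 k := by
          rw [Matrix.mul_apply, Finset.mul_sum]
          exact Finset.sum_congr rfl fun l _ => by ring
        rw [e2, ← Units.val_mul, mul_inv_cancel, Units.val_one, Matrix.one_apply]
        by_cases hk : k = 0
        · subst hk; simp
        · rw [if_neg (Ne.symm hk), if_neg hk, mul_zero]
      rw [hp_def, Units.val_mul, Matrix.mul_apply, Finset.sum_eq_single (0 : Fin (n + 2))]
      · rw [h1, if_pos rfl, permGL_inv, coe_permGL, permMatrix_apply', if_neg, mul_zero]
        have : (Fin.revPerm⁻¹ : Equiv.Perm (Fin (n + 2))) 0 = Fin.last (n + 1) := by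
          rw [Equiv.Perm.inv_def, Fin.revPerm_symm, Fin.revPerm_apply, Fin.rev_zero]
        rw [this]
        exact Ne.symm hj
      · intro k _ hk; rw [h1, if_neg hk, zero_mul]
      · intro h; exact absurd (Finset.mem_univ _) h
    rw [hg_eq]
    exact parabolic_mul_w₀_mul_mem hc hp hn'

/-- **The closed complement of the open cell is the hyperplane section `{g_{N-1,0} = 0}`.**
[cite: BernsteinZelevinskyASENS1977, §7.1] -/
theorem mem_cellLT_rev_iff_apply_eq_zero (g : GL (Fin (n + 2)) F) :
    g ∈ cellLT (K := F) (lastBlockLabel (n + 2)) Fin.revPerm ↔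
      (g : Matrix (Fin (n + 2)) (Fin (n + 2)) F) (Fin.last (n + 1)) 0 = 0 := by
  have hc : Monotone (lastBlockLabel (n + 2)) := monotone_lastBlockLabel (n + 2)
  have hunion := Set.eq_univ_iff_forall.1 (cellLT_rev_union (K := F) (lastBlockLabel (n + 2)) hc) g
  have hdisj := disjoint_cellLT_parabolicDoubleCoset (K := F) (lastBlockLabel (n + 2)) hc Fin.revPerm
  constructor
  · intro h
    by_contra h'
    exact Set.disjoint_left.1 hdisj h ((mem_parabolicDoubleCoset_rev_iff_apply_ne_zero g).2 h')
  · intro h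
    exact hunion.resolve_right fun h' => (mem_parabolicDoubleCoset_rev_iff_apply_ne_zero g).1 h' h

/-! ### The chart decomposition of the open `P`-orbit -/

/-- The last row of `p g` for `p ∈ Q_{N-1,1}` is `p_{N-1,N-1}` times the last row of `g`.
[cite: BernsteinZelevinskyASENS1977, §7.1] -/
theorem mul_apply_last_of_mem_standardParabolicGL {p : GL (Fin (n + 2)) F} (hp : p ∈ standardParabolicGL F (lastBlockLabel (n + 2)))
    (g : GL (Fin (n + 2)) F) (j : Fin (n + 2)) :
    ((p * g : GL (Fin (n + 2)) F) : Matrix (Fin (n + 2)) (Fin (n + 2)) F) (Fin.last (n + 1)) j =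
      (p : Matrix (Fin (n + 2)) (Fin (n + 2)) F) (Fin.last (n + 1)) (Fin.last (n + 1)) * (g : Matrix (Fin (n + 2)) (Fin (n + 2)) F) (Fin.last (n + 1)) j := by
  rw [Units.val_mul, Matrix.mul_apply, Finset.sum_eq_single (Fin.last (n + 1))]
  · intro l _ hl
    rw [(mem_standardParabolicGL_lastBlockLabel_iff p).1 hp l hl, zero_mul]
  · intro h; exact absurd (Finset.mem_univ _) h

/-- The diagonal entry `p_{N-1,N-1}` of `p ∈ Q_{N-1,1}` is non-zero. [cite: BernsteinZelevinskyASENS1977, §7.1] -/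
theorem apply_last_last_ne_zero_of_mem_standardParabolicGL {p : GL (Fin (n + 2)) F}
    (hp : p ∈ standardParabolicGL F (lastBlockLabel (n + 2))) :
    (p : Matrix (Fin (n + 2)) (Fin (n + 2)) F) (Fin.last (n + 1)) (Fin.last (n + 1)) ≠ 0 := by
  intro h
  have h1 := mul_apply_last_of_mem_standardParabolicGL hp p⁻¹ (Fin.last (n + 1))
  rw [mul_inv_cancel, Units.val_one, Matrix.one_apply_eq, h, zero_mul] at h1
  exact one_ne_zero h1

variable [ValuativeRel F] [TopologicalSpace F] [IsNonarchimedeanLocalField F]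
  {W : Type*} [AddCommGroup W] [Module ℂ W]
  (σ' : Representation ℂ ↥(standardParabolicGL F (lastBlockLabel (n + 2))) W)

/-- **Support away from the closed orbit.** If `f ∈ Ind_{Q_{N-1,1}}^{GL_N} σ'` vanishes on `P = Q_{N-1,1}`
and is fixed by the congruence subgroup `K_γ` (`γ < 1`), then `f(g) = 0` as soon as the first
`N - 1` entries of the last row of `g` are `γ`-small relative to `g_{N-1,N-1}`: such a `g` lies in
`P K_γ`. [cite: BernsteinZelevinskyASENS1977, §7.1] -/
theorem toFun_eq_zero_of_lastRow_le (f : Representation.SmoothInd (standardParabolicGL F (lastBlockLabel (n + 2))) σ')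
    (hf : ∀ p ∈ standardParabolicGL F (lastBlockLabel (n + 2)), f.toFun p = 0)
    {γ : ValueGroupWithZero F} (hγ : γ < 1)
    (hstab : (congruenceGL (n + 2) γ : Set (GL (Fin (n + 2)) F)) ⊆
      (Representation.smoothIndRep (standardParabolicGL F (lastBlockLabel (n + 2))) σ').stabilizerSubgroup f)
    {g : GL (Fin (n + 2)) F} (hg : ∀ k : Fin (n + 1), valuation F ((g : Matrix (Fin (n + 2)) (Fin (n + 2)) F) (Fin.last (n + 1)) (Fin.castSucc k)) ≤
      γ * valuation F ((g : Matrix (Fin (n + 2)) (Fin (n + 2)) F) (Fin.last (n + 1)) (Fin.last (n + 1)))) :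
    f.toFun g = 0 := by
  classical
  set t : F := (g : Matrix (Fin (n + 2)) (Fin (n + 2)) F) (Fin.last (n + 1)) (Fin.last (n + 1)) with ht
  -- `t ≠ 0`: otherwise the last row of `g` vanishes
  have ht0 : t ≠ 0 := by
    intro h0
    have hrow : ∀ j, (g : Matrix (Fin (n + 2)) (Fin (n + 2)) F) (Fin.last (n + 1)) j = 0 := by
      intro j
      by_cases hj : j = Fin.last (n + 1)
      · rw [hj]; exact h0
      · obtain ⟨k, rfl⟩ : ∃ k : Fin (n + 1), Fin.castSucc k = j := ⟨j.castPred hj, Fin.castSucc_castPred _ _⟩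
        have := hg k
        rw [h0, map_zero, mul_zero, le_zero_iff, map_eq_zero] at this
        exact this
    have h1 : ((g : Matrix (Fin (n + 2)) (Fin (n + 2)) F) * ((g⁻¹ : GL (Fin (n + 2)) F) : Matrix (Fin (n + 2)) (Fin (n + 2)) F)) (Fin.last (n + 1)) (Fin.last (n + 1)) = 1 := by
      rw [← Units.val_mul, mul_inv_cancel, Units.val_one, Matrix.one_apply_eq]
    rw [Matrix.mul_apply, Finset.sum_eq_zero (fun j _ => by rw [hrow j, zero_mul])] at h1
    exact zero_ne_one h1
  -- the element `k₀ ∈ K_γ`: the identity with last row replaced by `t⁻¹ · (last row of g)`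
  set Y : Matrix (Fin (n + 2)) (Fin (n + 2)) F := Matrix.of fun i j =>
    if i = Fin.last (n + 1) ∧ j ≠ Fin.last (n + 1) then t⁻¹ * (g : Matrix (Fin (n + 2)) (Fin (n + 2)) F) (Fin.last (n + 1)) j else 0 with hY
  have hYY : Y * Y = 0 := by
    ext i k
    rw [Matrix.mul_apply, Matrix.zero_apply]
    refine Finset.sum_eq_zero fun j _ => ?_
    simp only [hY, Matrix.of_apply]
    by_cases h1 : i = Fin.last (n + 1) ∧ j ≠ Fin.last (n + 1)
    · rw [if_neg (fun h2 : j = Fin.last (n + 1) ∧ k ≠ Fin.last (n + 1) => h1.2 h2.1), mul_zero]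
    · rw [if_neg h1, zero_mul]
  let k₀ : GL (Fin (n + 2)) F :=
    ⟨1 + Y, 1 - Y, by rw [add_mul, mul_sub, mul_sub, one_mul, mul_one, one_mul, hYY]; abel,
      by rw [sub_mul, mul_add, mul_add, one_mul, mul_one, one_mul, hYY]; abel⟩
  have hk₀val : (k₀ : Matrix (Fin (n + 2)) (Fin (n + 2)) F) = 1 + Y := rfl
  have hk₀K : k₀ ∈ congruenceGL (n + 2) γ := by
    refine mem_congruenceGL_of_valBound_sub_one hγ fun i j => ?_
    rw [hk₀val, add_sub_cancel_left, hY, Matrix.of_apply]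
    split_ifs with h
    · obtain ⟨k, rfl⟩ : ∃ k : Fin (n + 1), Fin.castSucc k = j := ⟨j.castPred h.2, Fin.castSucc_castPred _ _⟩
      rw [map_mul, map_inv₀]
      have htv : valuation F t ≠ 0 := (Valuation.ne_zero_iff _).2 ht0
      calc (valuation F t)⁻¹ * valuation F ((g : Matrix (Fin (n + 2)) (Fin (n + 2)) F) (Fin.last (n + 1)) (Fin.castSucc k))
          ≤ (valuation F t)⁻¹ * (γ * valuation F t) := mul_le_mul_right (hg k) _
        _ = γ := by rw [mul_comm γ, ← mul_assoc, inv_mul_cancel₀ htv, one_mul]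
    · rw [map_zero]; exact zero_le
  -- `g = p k₀` with `p ∈ P`: the last row of `g k₀⁻¹` is `t e_{N-1}`
  have hrow : ∀ j, t * (k₀ : Matrix (Fin (n + 2)) (Fin (n + 2)) F) (Fin.last (n + 1)) j = (g : Matrix (Fin (n + 2)) (Fin (n + 2)) F) (Fin.last (n + 1)) j := by
    intro j
    rw [hk₀val, Matrix.add_apply, hY, Matrix.of_apply]
    by_cases hj : j = Fin.last (n + 1)
    · rw [hj, Matrix.one_apply_eq, if_neg (fun h => h.2 rfl), add_zero, mul_one]
    · rw [Matrix.one_apply_ne (Ne.symm hj), if_pos ⟨rfl, hj⟩, zero_add, mul_inv_cancel_left₀ ht0]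
  have hp : g * k₀⁻¹ ∈ standardParabolicGL F (lastBlockLabel (n + 2)) := by
    rw [mem_standardParabolicGL_lastBlockLabel_iff]
    intro j hj
    have e1 : ((g * k₀⁻¹ : GL (Fin (n + 2)) F) : Matrix (Fin (n + 2)) (Fin (n + 2)) F) (Fin.last (n + 1)) j =
        t * ((k₀ : Matrix (Fin (n + 2)) (Fin (n + 2)) F) * ((k₀⁻¹ : GL (Fin (n + 2)) F) : Matrix (Fin (n + 2)) (Fin (n + 2)) F)) (Fin.last (n + 1)) j := by
      rw [Units.val_mul, Matrix.mul_apply, Matrix.mul_apply, Finset.mul_sum]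
      exact Finset.sum_congr rfl fun l _ => by rw [← hrow l, mul_assoc]
    rw [e1, ← Units.val_mul, mul_inv_cancel, Units.val_one, Matrix.one_apply_ne (Ne.symm hj), mul_zero]
  have e2 : g = ((⟨g * k₀⁻¹, hp⟩ : ↥(standardParabolicGL F (lastBlockLabel (n + 2)))) : GL (Fin (n + 2)) F) * (1 * k₀) := by
    rw [one_mul]; exact (inv_mul_cancel_right g k₀).symm
  have e3 : f.toFun (1 * k₀) = 0 := by
    rw [toFun_w₀_mul_mul_of_mem_stabilizer (hstab hk₀K), hf 1 (Subgroup.one_mem _)]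
  rw [e2, Representation.SmoothInd.toFun_subgroup_mul, e3, map_zero]


omit [TopologicalSpace F] [IsNonarchimedeanLocalField F] in
/-- **Perturbation of the last row under a congruence subgroup**: for `k ∈ K_γ'`,
`v((g k)_{N-1,j} - g_{N-1,j}) ≤ B γ'` whenever all entries of the last row of `g` have valuation `≤ B`.
[cite: BernsteinZelevinskyASENS1977, §7.1] -/
theorem valuation_mul_apply_last_sub_le (g : GL (Fin (n + 2)) F) {γ' : ValueGroupWithZero F} {k : GL (Fin (n + 2)) F}
    (hk : k ∈ congruenceGL (n + 2) γ') {B : ValueGroupWithZero F}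
    (hB : ∀ l : Fin (n + 2), valuation F ((g : Matrix (Fin (n + 2)) (Fin (n + 2)) F) (Fin.last (n + 1)) l) ≤ B) (j : Fin (n + 2)) :
    valuation F (((g * k : GL (Fin (n + 2)) F) : Matrix (Fin (n + 2)) (Fin (n + 2)) F) (Fin.last (n + 1)) j - (g : Matrix (Fin (n + 2)) (Fin (n + 2)) F) (Fin.last (n + 1)) j) ≤ B * γ' := by
  have e1 : ((g * k : GL (Fin (n + 2)) F) : Matrix (Fin (n + 2)) (Fin (n + 2)) F) (Fin.last (n + 1)) j - (g : Matrix (Fin (n + 2)) (Fin (n + 2)) F) (Fin.last (n + 1)) j =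
      ∑ l, (g : Matrix (Fin (n + 2)) (Fin (n + 2)) F) (Fin.last (n + 1)) l * (((k : Matrix (Fin (n + 2)) (Fin (n + 2)) F) - 1) l j) := by
    have h1 : (g : Matrix (Fin (n + 2)) (Fin (n + 2)) F) (Fin.last (n + 1)) j = ∑ l, (g : Matrix (Fin (n + 2)) (Fin (n + 2)) F) (Fin.last (n + 1)) l * (1 : Matrix (Fin (n + 2)) (Fin (n + 2)) F) l j := by
      rw [← Matrix.mul_apply, Matrix.mul_one]
    rw [Units.val_mul, Matrix.mul_apply, h1, ← Finset.sum_sub_distrib]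
    exact Finset.sum_congr rfl fun l _ => by rw [Matrix.sub_apply, mul_sub]
  rw [e1]
  refine Valuation.map_sum_le _ fun l _ => ?_
  rw [map_mul]
  exact mul_le_mul' (hB l) (hk.2.1 l j)

/-- **The charts are locally constant on the support.** Let `f ∈ Ind_{Q_{N-1,1}}^{GL_N} σ'` vanish on
`P`, be fixed by `K_{ϖ^m}` (`m ≥ 1`), and let `f(g) ≠ 0`. Then for `k ∈ K_{ϖ^{m+1}}` the pattern of the
valuations of the first `N - 1` entries of the last rows of `g` and `g k` is the same: the index `i` is
the first one of maximal valuation for `g` iff it is for `g k`. [cite: BernsteinZelevinskyASENS1977, §7.1] -/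
theorem chart_mul_iff_of_toFun_ne_zero (f : Representation.SmoothInd (standardParabolicGL F (lastBlockLabel (n + 2))) σ')
    (hf : ∀ p ∈ standardParabolicGL F (lastBlockLabel (n + 2)), f.toFun p = 0)
    {ϖ : F} (hϖ : IsUniformizingElement ϖ) {m : ℕ} (hm1 : 1 ≤ m)
    (hstab : (congruenceGL (n + 2) (valuation F ϖ ^ m) : Set (GL (Fin (n + 2)) F)) ⊆ (Representation.smoothIndRep (standardParabolicGL F (lastBlockLabel (n + 2))) σ').stabilizerSubgroup f)
    {g : GL (Fin (n + 2)) F} (hg : f.toFun g ≠ 0) {k : GL (Fin (n + 2)) F} (hk : k ∈ congruenceGL (n + 2) (valuation F ϖ ^ (m + 1)))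
    (i : Fin (n + 1)) :
    ((∀ k' : Fin (n + 1), valuation F (((g * k : GL (Fin (n + 2)) F) : Matrix (Fin (n + 2)) (Fin (n + 2)) F) (Fin.last (n + 1)) (Fin.castSucc k')) ≤
        valuation F (((g * k : GL (Fin (n + 2)) F) : Matrix (Fin (n + 2)) (Fin (n + 2)) F) (Fin.last (n + 1)) (Fin.castSucc i))) ∧
      ∀ k' : Fin (n + 1), k' < i → valuation F (((g * k : GL (Fin (n + 2)) F) : Matrix (Fin (n + 2)) (Fin (n + 2)) F) (Fin.last (n + 1)) (Fin.castSucc k')) <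
        valuation F (((g * k : GL (Fin (n + 2)) F) : Matrix (Fin (n + 2)) (Fin (n + 2)) F) (Fin.last (n + 1)) (Fin.castSucc i))) ↔
    ((∀ k' : Fin (n + 1), valuation F ((g : Matrix (Fin (n + 2)) (Fin (n + 2)) F) (Fin.last (n + 1)) (Fin.castSucc k')) ≤
        valuation F ((g : Matrix (Fin (n + 2)) (Fin (n + 2)) F) (Fin.last (n + 1)) (Fin.castSucc i))) ∧
      ∀ k' : Fin (n + 1), k' < i → valuation F ((g : Matrix (Fin (n + 2)) (Fin (n + 2)) F) (Fin.last (n + 1)) (Fin.castSucc k')) <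
        valuation F ((g : Matrix (Fin (n + 2)) (Fin (n + 2)) F) (Fin.last (n + 1)) (Fin.castSucc i))) := by
  classical
  set γ : ValueGroupWithZero F := valuation F ϖ ^ m with hγ
  have hγ1 : γ < 1 := hϖ.valuation_pow_lt_one hm1
  have hvϖ0 : valuation F ϖ ≠ 0 := (Valuation.ne_zero_iff _).mpr hϖ.ne_zero
  -- shorthand for the valuations of the last rows
  set vg : Fin (n + 1) → ValueGroupWithZero F := fun k' => valuation F ((g : Matrix (Fin (n + 2)) (Fin (n + 2)) F) (Fin.last (n + 1)) (Fin.castSucc k'))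
    with hvg
  set vgk : Fin (n + 1) → ValueGroupWithZero F := fun k' =>
    valuation F (((g * k : GL (Fin (n + 2)) F) : Matrix (Fin (n + 2)) (Fin (n + 2)) F) (Fin.last (n + 1)) (Fin.castSucc k')) with hvgk
  -- the maximum `M` of the `vg`, attained at `k₁`, and the key inequality `γ v(g_LL) < M`
  obtain ⟨k₁, -, hk₁⟩ := Finset.exists_max_image Finset.univ vg Finset.univ_nonempty
  set M := vg k₁ with hM
  have hle : ∀ k', vg k' ≤ M := fun k' => hk₁ k' (Finset.mem_univ _)
  have hLL : γ * valuation F ((g : Matrix (Fin (n + 2)) (Fin (n + 2)) F) (Fin.last (n + 1)) (Fin.last (n + 1))) < M := by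
    by_contra h
    rw [not_lt] at h
    exact hg (toFun_eq_zero_of_lastRow_le σ' f hf hγ1 hstab fun k' => (hle k').trans h)
  have hM0 : M ≠ 0 := by
    intro h0; rw [h0] at hLL; exact not_lt_of_ge zero_le hLL
  have hy0 : (g : Matrix (Fin (n + 2)) (Fin (n + 2)) F) (Fin.last (n + 1)) (Fin.castSucc k₁) ≠ 0 := fun h => hM0 (by rw [hM, hvg]; simp [h])
  -- the perturbation is `≤ M · v(ϖ) < M`
  have hγ0 : γ ≠ 0 := pow_ne_zero _ hvϖ0
  have hpert : ∀ k', valuation F (((g * k : GL (Fin (n + 2)) F) : Matrix (Fin (n + 2)) (Fin (n + 2)) F) (Fin.last (n + 1)) (Fin.castSucc k') -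
      (g : Matrix (Fin (n + 2)) (Fin (n + 2)) F) (Fin.last (n + 1)) (Fin.castSucc k')) ≤ M * valuation F ϖ := by
    intro k'
    have hB : ∀ l : Fin (n + 2), valuation F ((g : Matrix (Fin (n + 2)) (Fin (n + 2)) F) (Fin.last (n + 1)) l) ≤ γ⁻¹ * M := by
      intro l
      by_cases hl : l = Fin.last (n + 1)
      · rw [hl]
        have := mul_le_mul_right hLL.le γ⁻¹
        rwa [← mul_assoc, inv_mul_cancel₀ hγ0, one_mul] at this
      · obtain ⟨k', rfl⟩ : ∃ k' : Fin (n + 1), Fin.castSucc k' = l := ⟨l.castPred hl, Fin.castSucc_castPred _ _⟩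
        refine (hle k').trans ?_
        have hγinv : 1 ≤ γ⁻¹ := one_le_inv_iff₀.2 ⟨lt_of_le_of_ne zero_le hγ0.symm, hγ1.le⟩
        exact le_mul_of_one_le_left' hγinv
    refine (valuation_mul_apply_last_sub_le g hk hB (Fin.castSucc k')).trans (le_of_eq ?_)
    rw [pow_succ, ← hγ, mul_comm γ⁻¹ M, mul_assoc, ← mul_assoc γ⁻¹, inv_mul_cancel₀ hγ0, one_mul]
  have hMϖ : M * valuation F ϖ < M := mul_lt_of_lt_one_right (lt_of_le_of_ne zero_le hM0.symm) hϖ.valuation_lt_one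
  -- (i) maximal entries stay maximal, (ii) non-maximal entries stay non-maximal
  have hsame : ∀ k', vg k' = M → vgk k' = M := by
    intro k' h
    have e : ((g * k : GL (Fin (n + 2)) F) : Matrix (Fin (n + 2)) (Fin (n + 2)) F) (Fin.last (n + 1)) (Fin.castSucc k') =
        (g : Matrix (Fin (n + 2)) (Fin (n + 2)) F) (Fin.last (n + 1)) (Fin.castSucc k') +
          (((g * k : GL (Fin (n + 2)) F) : Matrix (Fin (n + 2)) (Fin (n + 2)) F) (Fin.last (n + 1)) (Fin.castSucc k') - (g : Matrix (Fin (n + 2)) (Fin (n + 2)) F) (Fin.last (n + 1)) (Fin.castSucc k')) := by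
      ring
    change valuation F _ = M
    rw [e, Valuation.map_add_eq_of_lt_left]
    · exact h
    · calc valuation F _ ≤ M * valuation F ϖ := hpert k'
        _ < M := hMϖ
        _ = _ := h.symm
  have hsmall : ∀ k', vg k' < M → vgk k' < M := by
    intro k' h
    -- discreteness: `vg k' < M = v(y)` forces `vg k' ≤ M v(ϖ)`
    have h' : vg k' ≤ M * valuation F ϖ := by
      have hq : valuation F ((g : Matrix (Fin (n + 2)) (Fin (n + 2)) F) (Fin.last (n + 1)) (Fin.castSucc k') / (g : Matrix (Fin (n + 2)) (Fin (n + 2)) F) (Fin.last (n + 1)) (Fin.castSucc k₁)) < 1 := by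
        rw [map_div₀, div_lt_one₀ (lt_of_le_of_ne zero_le hM0.symm)]; exact h
      rw [valuation_lt_one_iff_le_valuation hϖ, map_div₀, div_le_iff₀ (lt_of_le_of_ne zero_le hM0.symm)] at hq
      rwa [mul_comm] at hq
    have e : ((g * k : GL (Fin (n + 2)) F) : Matrix (Fin (n + 2)) (Fin (n + 2)) F) (Fin.last (n + 1)) (Fin.castSucc k') =
        (g : Matrix (Fin (n + 2)) (Fin (n + 2)) F) (Fin.last (n + 1)) (Fin.castSucc k') +
          (((g * k : GL (Fin (n + 2)) F) : Matrix (Fin (n + 2)) (Fin (n + 2)) F) (Fin.last (n + 1)) (Fin.castSucc k') - (g : Matrix (Fin (n + 2)) (Fin (n + 2)) F) (Fin.last (n + 1)) (Fin.castSucc k')) := by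
      ring
    change valuation F _ < M
    rw [e]
    exact (Valuation.map_add_le _ h' (hpert k')).trans_lt hMϖ
  -- the maximum of the `vgk` is again `M`
  have hle' : ∀ k', vgk k' ≤ M := by
    intro k'
    rcases (hle k').lt_or_eq with h | h
    · exact (hsmall k' h).le
    · exact (hsame k' h).le
  have hmax' : vgk k₁ = M := hsame k₁ rfl
  -- both sides say: `v_i = M` and `v_{k'} < M` for `k' < i`
  have key : ∀ (v : Fin (n + 1) → ValueGroupWithZero F), (∀ k', v k' ≤ M) → v k₁ = M →
      (((∀ k', v k' ≤ v i) ∧ ∀ k', k' < i → v k' < v i) ↔ (v i = M ∧ ∀ k', k' < i → v k' < M)) := by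
    intro v hv hk₁
    constructor
    · rintro ⟨h1, h2⟩
      have hi : v i = M := le_antisymm (hv i) (hk₁ ▸ h1 k₁)
      exact ⟨hi, fun k' hk' => hi ▸ h2 k' hk'⟩
    · rintro ⟨hi, h2⟩
      exact ⟨fun k' => hi ▸ hv k', fun k' hk' => hi ▸ h2 k' hk'⟩
  change ((∀ k', vgk k' ≤ vgk i) ∧ ∀ k', k' < i → vgk k' < vgk i) ↔ ((∀ k', vg k' ≤ vg i) ∧ ∀ k', k' < i → vg k' < vg i)
  rw [key vgk hle' hmax', key vg hle rfl]
  constructor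
  · rintro ⟨hi, h2⟩
    have hgi : vg i = M := by
      rcases (hle i).lt_or_eq with h | h
      · exact absurd hi (hsmall i h).ne
      · exact h
    refine ⟨hgi, fun k' hk' => ?_⟩
    rcases (hle k').lt_or_eq with h | h
    · exact h
    · exact absurd (hsame k' h) (h2 k' hk').ne
  · rintro ⟨hi, h2⟩
    exact ⟨hsame i hi, fun k' hk' => hsmall k' (h2 k' hk')⟩

omit [ValuativeRel F] [TopologicalSpace F] [IsNonarchimedeanLocalField F] in
/-- Entries of `g P_σ`: `(g P_σ)_{a b} = g_{a, σ⁻¹ b}`. [cite: BernsteinZelevinskyASENS1977, §7.1] -/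
theorem mul_permGL_apply (g : GL (Fin (n + 2)) F) (σ : Equiv.Perm (Fin (n + 2))) (a b : Fin (n + 2)) :
    ((g * permGL σ : GL (Fin (n + 2)) F) : Matrix (Fin (n + 2)) (Fin (n + 2)) F) a b = (g : Matrix (Fin (n + 2)) (Fin (n + 2)) F) a (σ.symm b) := by
  rw [Units.val_mul, Matrix.mul_apply, Finset.sum_eq_single (σ.symm b)]
  · rw [coe_permGL, permMatrix_apply', Equiv.apply_symm_apply, if_pos rfl, mul_one]
  · intro l _ hl
    rw [coe_permGL, permMatrix_apply', if_neg (fun h => hl (by rw [← h, Equiv.symm_apply_apply])), mul_zero]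
  · intro h; exact absurd (Finset.mem_univ _) h

/-- **The chart decomposition of the open `Q_{N-1,1}`-orbit.** Every `f ∈ Ind_{Q_{N-1,1}}^{GL_N} σ'`
vanishing on `P = Q_{N-1,1}` is a sum `f = ∑_{i < N-1} w_i · f_i` of translates, by the transpositions
`w_i = (0 i)` of the Levi, of functions `f_i` vanishing off the open cell `P w₀ U_N` (i.e. `f_i ∈ I_open`):
`f_i = w_i · (f · 1_{E_i})` where `E_i` is the (left `P`-invariant, clopen on the support of `f`) set of
`g` for which `i` is the first index of maximal valuation among the first `N - 1` entries of the last row.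
(The open orbit `P w₀ P = GL_N ∖ P` of Bernstein–Zelevinsky 1977, §7.1, is covered by the translates
`(P w₀ U_N) w_i`.) [cite: BernsteinZelevinskyASENS1977, §7.1] -/
theorem exists_sum_smoothIndRep_swap_of_forall_toFun_eq_zero
    (f : Representation.SmoothInd (standardParabolicGL F (lastBlockLabel (n + 2))) σ')
    (hf : ∀ p ∈ standardParabolicGL F (lastBlockLabel (n + 2)), f.toFun p = 0) :
    ∃ fi : Fin (n + 1) → Representation.SmoothInd (standardParabolicGL F (lastBlockLabel (n + 2))) σ',
      (∀ i, fi i ∈ vanishingOn (standardParabolicGL F (lastBlockLabel (n + 2))) σ'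
        (cellLT (K := F) (lastBlockLabel (n + 2)) Fin.revPerm)) ∧
      f = ∑ i, Representation.smoothIndRep (standardParabolicGL F (lastBlockLabel (n + 2))) σ' (permGL (Equiv.swap 0 (Fin.castSucc i))) (fi i) := by
  classical
  -- a uniformizer and the level of `f`
  obtain ⟨ϖ, hϖ⟩ := exists_isUniformizingElement (F := F)
  obtain ⟨m, hm1, hstab⟩ := exists_congruenceGL_pow_subset (n := n + 2) hϖ
    ((Representation.isSmooth_smoothInd (standardParabolicGL F (lastBlockLabel (n + 2))) σ' f).mem_nhds
      (Subgroup.one_mem _))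
  have hvϖ0 : valuation F ϖ ≠ 0 := (Valuation.ne_zero_iff _).mpr hϖ.ne_zero
  -- the charts `E i`
  set vrow : GL (Fin (n + 2)) F → Fin (n + 1) → ValueGroupWithZero F := fun g k =>
    valuation F ((g : Matrix (Fin (n + 2)) (Fin (n + 2)) F) (Fin.last (n + 1)) (Fin.castSucc k)) with hvrow
  set E : Fin (n + 1) → Set (GL (Fin (n + 2)) F) := fun i =>
    {g | (∀ k, vrow g k ≤ vrow g i) ∧ ∀ k, k < i → vrow g k < vrow g i} with hE
  -- (a) every `g` lies in exactly one chart
  have hEex : ∀ g, ∃ i, g ∈ E i := by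
    intro g
    obtain ⟨k₁, -, hk₁⟩ := Finset.exists_max_image Finset.univ (vrow g) Finset.univ_nonempty
    set S : Finset (Fin (n + 1)) := Finset.univ.filter fun i => ∀ k, vrow g k ≤ vrow g i with hS
    have hSne : S.Nonempty := ⟨k₁, Finset.mem_filter.2 ⟨Finset.mem_univ _, fun k => hk₁ k (Finset.mem_univ _)⟩⟩
    refine ⟨S.min' hSne, (Finset.mem_filter.1 (Finset.min'_mem S hSne)).2, fun k hk => ?_⟩
    have hkS : k ∉ S := fun h => not_le.2 hk (Finset.min'_le S k h)
    rw [hS, Finset.mem_filter, not_and] at hkS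
    obtain ⟨k', hk'⟩ := not_forall.1 (hkS (Finset.mem_univ _))
    exact (not_le.1 hk').trans_le ((Finset.mem_filter.1 (Finset.min'_mem S hSne)).2 k')
  have hEuniq : ∀ g i i', g ∈ E i → g ∈ E i' → i = i' := by
    intro g i i' hi hi'
    by_contra hne
    rcases lt_or_gt_of_ne hne with h | h
    · exact absurd (hi.1 i') (not_le.2 (hi'.2 i h))
    · exact absurd (hi'.1 i) (not_le.2 (hi.2 i' h))
  -- (b) the charts are left `P`-invariant
  have hEP : ∀ {p : GL (Fin (n + 2)) F}, p ∈ standardParabolicGL F (lastBlockLabel (n + 2)) → ∀ g i, p * g ∈ E i ↔ g ∈ E i := by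
    intro p hp g i
    have ht : valuation F ((p : Matrix (Fin (n + 2)) (Fin (n + 2)) F) (Fin.last (n + 1)) (Fin.last (n + 1))) ≠ 0 :=
      (Valuation.ne_zero_iff _).2 (apply_last_last_ne_zero_of_mem_standardParabolicGL hp)
    have hv : ∀ k, vrow (p * g) k = valuation F ((p : Matrix (Fin (n + 2)) (Fin (n + 2)) F) (Fin.last (n + 1)) (Fin.last (n + 1))) * vrow g k := by
      intro k; simp only [hvrow]; rw [mul_apply_last_of_mem_standardParabolicGL hp, map_mul]
    have hcancel : ∀ {u w : ValueGroupWithZero F},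
        valuation F ((p : Matrix (Fin (n + 2)) (Fin (n + 2)) F) (Fin.last (n + 1)) (Fin.last (n + 1))) * u ≤
          valuation F ((p : Matrix (Fin (n + 2)) (Fin (n + 2)) F) (Fin.last (n + 1)) (Fin.last (n + 1))) * w ↔ u ≤ w := by
      intro u w
      refine ⟨fun h => ?_, fun h => mul_le_mul_right h _⟩
      have := mul_le_mul_right h (valuation F ((p : Matrix (Fin (n + 2)) (Fin (n + 2)) F) (Fin.last (n + 1)) (Fin.last (n + 1))))⁻¹
      rwa [inv_mul_cancel_left₀ ht, inv_mul_cancel_left₀ ht] at this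
    simp only [hE, Set.mem_setOf_eq, hv]
    refine and_congr (forall_congr' fun k => hcancel) (forall_congr' fun k => imp_congr_right fun _ => ?_)
    exact lt_iff_lt_of_le_iff_le hcancel
  -- (c) the charts are right `K_{ϖ^{m+1}}`-invariant on the support of `f`
  have hEK : ∀ {g : GL (Fin (n + 2)) F}, f.toFun g ≠ 0 → ∀ {k : GL (Fin (n + 2)) F}, k ∈ congruenceGL (n + 2) (valuation F ϖ ^ (m + 1)) →
      ∀ i, g * k ∈ E i ↔ g ∈ E i :=
    fun hg k hk i => chart_mul_iff_of_toFun_ne_zero σ' f hf hϖ hm1 hstab hg hk i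
  have hKsub : (congruenceGL (n + 2) (valuation F ϖ ^ (m + 1)) : Set (GL (Fin (n + 2)) F)) ⊆ (Representation.smoothIndRep (standardParabolicGL F (lastBlockLabel (n + 2))) σ').stabilizerSubgroup f :=
    fun k hk => hstab (congruenceGL_mono (pow_le_pow_right_of_le_one' hϖ.valuation_le_one (Nat.le_succ m)) hk)
  -- (d) the pieces `f · 1_{E i}` as elements of `Ind`
  have hpiece : ∀ i, ∃ Fi : Representation.SmoothInd (standardParabolicGL F (lastBlockLabel (n + 2))) σ',
      ∀ g, Fi.toFun g = if g ∈ E i then f.toFun g else 0 := by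
    intro i
    refine ⟨⟨⟨fun g => if g ∈ E i then f.toFun g else 0, (Representation.mem_indFun_iff _ _ _).2 fun p g => ?_⟩, ?_⟩,
      fun g => rfl⟩
    · -- `P`-equivariance
      change (if (p : GL (Fin (n + 2)) F) * g ∈ E i then f.toFun ((p : GL (Fin (n + 2)) F) * g) else 0) = σ' p (if g ∈ E i then f.toFun g else 0)
      by_cases h : g ∈ E i
      · rw [if_pos ((hEP p.2 g i).2 h), if_pos h]
        exact Representation.SmoothInd.toFun_subgroup_mul f p g
      · rw [if_neg (fun h' => h ((hEP p.2 g i).1 h')), if_neg h, map_zero]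
    · -- smoothness: the stabiliser contains `K_{ϖ^{m+1}}`
      refine Representation.isSmoothVector_of_le _
        (isOpen_congruenceGL (pow_ne_zero _ hvϖ0) : IsOpen ((congruenceGL (n + 2) (valuation F ϖ ^ (m + 1)) : Set (GL (Fin (n + 2)) F))))
        fun k hk => ?_
      rw [Representation.mem_stabilizerSubgroup]
      refine Subtype.ext (funext fun g => ?_)
      change (if g * k ∈ E i then f.toFun (g * k) else 0) = if g ∈ E i then f.toFun g else 0
      have hfgk : f.toFun (g * k) = f.toFun g := toFun_w₀_mul_mul_of_mem_stabilizer (hKsub hk) g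
      by_cases hg : f.toFun g = 0
      · rw [hfgk, hg]; simp
      · by_cases h : g ∈ E i
        · rw [if_pos ((hEK hg hk i).2 h), if_pos h, hfgk]
        · rw [if_neg (fun h' => h ((hEK hg hk i).1 h')), if_neg h]
  choose Fi hFi using hpiece
  -- (e) `∑ Fi = f`
  have hsum : ∑ i, Fi i = f := by
    apply Representation.SmoothInd.ext
    funext g
    rw [Representation.SmoothInd.toFun_sum]
    obtain ⟨i₀, hi₀⟩ := hEex g
    rw [Finset.sum_eq_single i₀]
    · rw [hFi, if_pos hi₀]
    · intro i _ hi
      rw [hFi, if_neg (fun h => hi (hEuniq g i i₀ h hi₀))]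
    · intro h; exact absurd (Finset.mem_univ _) h
  -- (f) the translates `fi i = w_i · Fi i` vanish off the open cell
  have hww : ∀ i : Fin (n + 1), (permGL (Equiv.swap 0 (Fin.castSucc i)) : GL (Fin (n + 2)) F) * permGL (Equiv.swap 0 (Fin.castSucc i)) = 1 := by
    intro i; rw [permGL_mul_permGL, Equiv.swap_mul_self, permGL_one]
  refine ⟨fun i => Representation.smoothIndRep (standardParabolicGL F (lastBlockLabel (n + 2))) σ' (permGL (Equiv.swap 0 (Fin.castSucc i))) (Fi i), fun i g hg => ?_, ?_⟩
  · rw [Representation.toFun_smoothIndRep_apply, hFi]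
    -- the `(N-1, i)` entry of `g w_i` is `g_{N-1,0} = 0`
    rw [mem_cellLT_rev_iff_apply_eq_zero] at hg
    have h0 : ((g * permGL (Equiv.swap 0 (Fin.castSucc i)) : GL (Fin (n + 2)) F) : Matrix (Fin (n + 2)) (Fin (n + 2)) F) (Fin.last (n + 1)) (Fin.castSucc i) = 0 := by
      rw [mul_permGL_apply, Equiv.symm_swap, Equiv.swap_apply_right]; exact hg
    split_ifs with hmem
    · -- then all first-block entries of the last row vanish, so `g w_i ∈ P` and `f` vanishes there
      refine hf _ ((mem_standardParabolicGL_lastBlockLabel_iff _).2 fun j hj => ?_)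
      obtain ⟨k, rfl⟩ : ∃ k : Fin (n + 1), Fin.castSucc k = j := ⟨j.castPred hj, Fin.castSucc_castPred _ _⟩
      have := hmem.1 k
      simp only [hvrow, h0, map_zero, le_zero_iff, map_eq_zero] at this
      exact this
    · rfl
  · rw [← hsum]
    refine Finset.sum_congr rfl fun i _ => ?_
    rw [← Module.End.mul_apply, ← map_mul, hww, map_one, Module.End.one_apply]

end Literature.NumberTheory.Automorphic.Zelevinsky1980

end
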